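import Mathlib.Analysis.Calculus.MeanValue
import Summits.QuantumFields.BalabanUV.T4Continuum.Spine.NE4.Targets
import Summits.QuantumFields.BalabanUV.Beta.EriceRemainderEnclosureHistoryRenewal

/-!
# Spine/NE4/FadingFromRate — at node U2, FADING MEMORY IS NOT AN INDEPENDENT HYPOTHESIS: it follows from NE4 itself
# (`ScaleShiftRate`) plus C^{1,1} REGULARITY of `β_{k+1}` in each coupling (a BOUND, no decay), at the price `θ ↦ √θ`

Cell `pub-balaban-gaps` (YM blitz G2), seat `ne4`, generation 3 (unit `pub-balaban-gaps-ne4-g3`); record `HOME/ne/NE4.md` §5 (R29).  Sequel of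
`Spine/NE4/Targets` (g0: node U2's input TRIPLE `ScaleShiftRate ∧ HistLipschitz Λ ∧ FadingMemory C θ Λ` on the data) and `Spine/NE4/Necessity`
(g2); uses (E33a) `Beta.EriceRemainderEnclosureHistoryRenewal.abs_sub_shift_le_geom` (lineage `b2b-balaban-beta-d4-p2`) BY NAME.

THE POINT.  Node U2 closes the two-run coupling matching with THREE β-side hypothesis shapes (`T4CouplingMatching`, all UNPRINTED): NE4
proper `ScaleShiftRate c θ γ β`, history moduli `HistLipschitz Λ γ β`, and their DECAY `FadingMemory C θ Λ` (`Λ k i ≤ C·θ^{k−i}`), the last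
described in its docstring as *"a genuine structural claim … terms born at scale i … are irrelevant and contract"*.  NO SUCH CONTRACTION
MECHANISM IS NEEDED AT NODE U2: the decay of the moduli in the age `k − i` is FORCED by NE4 plus mere REGULARITY of `β_{k+1}` in each coupling —
 (E33a) under `ScaleShiftRate c θ γ β`, two histories in the box agreeing on their entries YOUNGER than `g_i` have `β`-values within
   `(2c∕(θ(1−θ)))·θ^{k−i}` (delete the `i+1` oldest couplings of both): the OSCILLATION of `β_{k+1}` in `g_i` is `O(θ^{age})`, whatever its
   Lipschitz constant (§2);
 (Landau) a one-variable function on an interval of length `γ` with oscillation `≤ ε` and an `M`-Lipschitz DERIVATIVE has `|f′| ≤ ε∕h + M·h`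
   for every step `0 < h ≤ γ∕2` — the elementary Landau–Kolmogorov interpolation (second-order Taylor estimate, §1);
 (step `h = (γ∕2)·τ^{age}`, `θ ≤ τ²`) the Lipschitz constant of `β_{k+1}` in `g_i` is `≤ C₁·τ^{k−i}`, `C₁ = 2E₀∕γ + Mγ∕2`,
   `E₀ = max(2B, 2c∕(θ(1−θ)))` (`|β| ≤ B` caps the oscillation in the LAST coupling, where NE4 says nothing): `HistLipschitz Λ₁ γ β ∧
   FadingMemory C₁ τ Λ₁`, `Λ₁ k i = C₁·τ^{k−i}` (§3, `histLipschitz_fadingMemory_of_smooth`), rate `τ = √θ` at best.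
Hence node U2 closes, with its GEOMETRIC K-UNIFORM output and the typed hand-off `T4CauchySum.InjectedRate` ∕ `Spine.NE4.U2Output` intact, from
NE4 + `CoordDerivLipschitz` + `|β| ≤ B` + the usual AF binders (§4, two radii: regularity on a fixed box `]0,γᵤ]`, runs in `]0,γ]`, window
`C₁(γᵤ)·((k₀+1)γ³ + 2γ∕b) ≤ (1−τ)∕2`).  Contrast: the no-fading road (E33c∕f∕g) (bounded ROW SUMS of `Λ`, no regularity) keeps
K-uniformity but loses the geometric SHAPE (`L·ρ^⌊√j⌋`) and needs the sign `BetaLowerH 0`.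

SHARPNESS OF THE RATE (remark, not formalised): under C^{1,1} alone `√θ` cannot be improved (`f(g) = θ^a·sin(g·√M·θ^{−a∕2})`: oscillation
`2θ^a`, `|f″| ≤ M`, Lipschitz constant `√M·θ^{a∕2}`); `n` Lipschitz derivatives give `θ^{(1−1∕(n+1))·age}`, analyticity with a uniform bound
on a complex neighbourhood (the printed *"(or analytic)"*) gives `θ^{age}·O(age)`.  Node U2's window tolerates any rate `< 1`.

WHAT THIS CHANGES IN THE ROW (NE4.md (R29)); status words do NOT change — NE4 NOT PRINTED, NOT PROVED, spine 0∕9: node U2's β-side input list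
shrinks from {NE4, history moduli, FADING of the moduli} to {NE4, C^{1,1}-regularity in each coupling with ONE constant, a uniform bound}.
The regularity is of the printed TYPE — [Balaban1987RG1] p. 264, of `β_{j+1}(g_j)`: *"It is a smooth function defined on the interval [0, γ],
(or analytic), uniformly bounded on this interval together with all derivatives"* — printed for the LAST coupling only; for the preceding
couplings print says only that the dependence exists (p. 298), so `CoordDerivLipschitz` for `i < k` is UNPRINTED (GAPS G-t4-U2-2), but it is
a BOUND, not a decay statement.

HONEST FRAMING: bookkeeping + elementary real analysis over the tree's HYPOTHESIS SHAPES on an ABSTRACT family `β : FlowStep.HBeta` and the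
abstract data `D : FiniteEpsData`; nothing of Bałaban's asserted beyond print; NE4 NOT IN PRINT, NOT PROVED; spine PROVED 0∕9 unchanged; NOT
the continuum limit on ℝ⁴, NOT infinite volume, NOT a mass gap, NOT Clay.  HONEST DEPENDENCY: continuum YM on T⁴ ⇐ BetaPertH ∧ nine spine
estimates (0∕9 proved); BetaPertH ⇐ (D1) ∧ (D4) ∧ CAP+tail.  Reference (TYPES only): [Balaban1987RG1] = T. Bałaban, Commun. Math. Phys.
**109** (1987) 249–301, (0.20) p. 256, p. 264, p. 298.
-/

noncomputable section

namespace Summit.QuantumFields.BalabanUV.T4Continuum.Spine.NE4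

open Set
open Literature.MathematicalPhysics.QuantumFieldTheory.Balaban1983to89
open Literature.MathematicalPhysics.QuantumFieldTheory.Balaban1983to89.FlowStep
open Literature.MathematicalPhysics.QuantumFieldTheory.Balaban1983to89.T4CouplingMatching
open Literature.MathematicalPhysics.QuantumFieldTheory.Balaban1983to89.T4Continuum
open Summit.QuantumFields.BalabanUV.Beta.EriceRemainderEnclosureHistoryRenewal (abs_sub_shift_le_geom)

universe u

/-! ## §1 One variable: oscillation + Lipschitz derivative ⇒ small derivative (Landau–Kolmogorov on an interval) -/

/-- **LANDAU–KOLMOGOROV INTERPOLATION ON `]0,γ]`.**  If `f` is differentiable within `[0,γ]` with an `M`-Lipschitz derivative `f′`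
(`M ≥ 0`) and the OSCILLATION of `f` on `]0,γ]` is `≤ ε`, then `|f′ x| ≤ ε∕h + M·h` on `]0,γ]` for every step `0 < h ≤ γ∕2` (second-order
Taylor estimate `|f y − f x − f′x·(y − x)| ≤ M·h²` at `y = x ± h ∈ ]0,γ]`, mean value inequality). [folklore] -/
theorem abs_deriv_le_of_osc {f f' : ℝ → ℝ} {γ ε M h : ℝ}
    (hd : ∀ x ∈ Icc (0 : ℝ) γ, HasDerivWithinAt f (f' x) (Icc (0 : ℝ) γ) x)
    (hM : ∀ x ∈ Icc (0 : ℝ) γ, ∀ y ∈ Icc (0 : ℝ) γ, |f' x - f' y| ≤ M * |x - y|) (hM0 : 0 ≤ M)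
    (hε : ∀ x ∈ Ioc (0 : ℝ) γ, ∀ y ∈ Ioc (0 : ℝ) γ, |f x - f y| ≤ ε)
    (hh0 : 0 < h) (hhγ : h ≤ γ / 2) {x : ℝ} (hx : x ∈ Ioc (0 : ℝ) γ) :
    |f' x| ≤ ε / h + M * h := by
  -- a point `y ∈ ]0,γ]` at distance exactly `h` from `x`
  obtain ⟨y, hy, hyx⟩ : ∃ y ∈ Ioc (0 : ℝ) γ, |y - x| = h := by
    by_cases hxl : x ≤ γ / 2
    · refine ⟨x + h, ⟨by linarith [hx.1], by linarith⟩, ?_⟩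
      rw [add_sub_cancel_left, abs_of_pos hh0]
    · refine ⟨x - h, ⟨by linarith [not_le.mp hxl], by linarith [hx.2, hh0.le]⟩, ?_⟩
      rw [sub_sub_cancel_left, abs_neg, abs_of_pos hh0]
  have hxI : x ∈ Icc (0 : ℝ) γ := ⟨hx.1.le, hx.2⟩
  have hyI : y ∈ Icc (0 : ℝ) γ := ⟨hy.1.le, hy.2⟩
  have hS : uIcc x y ⊆ Icc (0 : ℝ) γ := uIcc_subset_Icc hxI hyI
  -- the Taylor remainder `g t = f t − t·f′x`
  set g : ℝ → ℝ := fun t => f t - t * f' x with hg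
  have hgd : ∀ t ∈ uIcc x y, HasDerivWithinAt g (f' t - f' x) (uIcc x y) t := fun t ht =>
    (((hd t (hS ht)).mono hS).sub ((hasDerivAt_mul_const (f' x)).hasDerivWithinAt))
  have hgb : ∀ t ∈ uIcc x y, ‖f' t - f' x‖ ≤ M * h := fun t ht => by
    rw [Real.norm_eq_abs]
    exact (hM t (hS ht) x hxI).trans (mul_le_mul_of_nonneg_left ((abs_sub_left_of_mem_uIcc ht).trans hyx.le) hM0)
  have hmv := (convex_uIcc x y).norm_image_sub_le_of_norm_hasDerivWithin_le hgd hgb left_mem_uIcc right_mem_uIcc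
  rw [Real.norm_eq_abs, Real.norm_eq_abs, hyx] at hmv
  have hid : g y - g x = (f y - f x) - (y - x) * f' x := by simp only [hg]; ring
  rw [hid] at hmv
  -- `h·|f′x| ≤ ε + M h²`
  have hkey : h * |f' x| ≤ ε + M * h * h := by
    have h1 : |(y - x) * f' x| ≤ |f y - f x| + M * h * h := by
      have := abs_sub_abs_le_abs_sub ((y - x) * f' x) (f y - f x)
      rw [abs_sub_comm ((y - x) * f' x)] at this
      linarith
    rw [abs_mul, hyx] at h1
    linarith [hε y hy x hx]
  rw [div_add' _ _ _ hh0.ne', le_div_iff₀ hh0]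
  nlinarith

/-- **LIPSCHITZ FROM A DERIVATIVE BOUND ON `]0,γ]`** (mean value inequality on the convex set `]0,γ]`). [folklore] -/
theorem abs_sub_le_of_deriv_bound {f f' : ℝ → ℝ} {γ L : ℝ}
    (hd : ∀ x ∈ Icc (0 : ℝ) γ, HasDerivWithinAt f (f' x) (Icc (0 : ℝ) γ) x)
    (hL : ∀ x ∈ Ioc (0 : ℝ) γ, |f' x| ≤ L) {s t : ℝ} (hs : s ∈ Ioc (0 : ℝ) γ) (ht : t ∈ Ioc (0 : ℝ) γ) :
    |f t - f s| ≤ L * |t - s| := by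
  have key := (convex_Ioc (0 : ℝ) γ).norm_image_sub_le_of_norm_hasDerivWithin_le
    (fun x hx => (hd x (Ioc_subset_Icc_self hx)).mono Ioc_subset_Icc_self)
    (fun x hx => by simpa [Real.norm_eq_abs] using hL x hx) hs ht
  simpa [Real.norm_eq_abs] using key

/-! ## §2 The regularity shape, and NE4's cap on the oscillation in the old couplings -/

/-- [shape] HYPOTHESIS SHAPE — **C^{1,1} REGULARITY OF `β_{k+1}` IN EACH COUPLING, ONE CONSTANT, NO DECAY**: for every scale `k`, every history
`p ∈ ]0,γ]^{k+1}` and every coordinate `i ≤ k`, the one-variable map `g ↦ β_{k+1}(…, g_i = g, …)` is differentiable within `[0,γ]`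
with an `M`-LIPSCHITZ derivative there, the same `M` for all `k`, `i`, `p`.  For the LAST coupling `i = k` this is (a C^{1,1} reading of)
the printed clause of [Balaban1987RG1] p. 264 *"smooth function defined on the interval [0, γ], (or analytic), uniformly bounded on this
interval together with all derivatives"* (its uniformity in `k` unprinted, GAPS G-adv2-3; sibling `BetaDerivClause.LastVarDerivBound`);
for the PRECEDING couplings `i < k` print says only that the dependence exists (p. 298), so there it is UNPRINTED (GAPS G-t4-U2-2) — but it
is a BOUND on derivatives, not a statement of decay in the age `k − i`.  A parametric definition of a proposition, consumed only as a
hypothesis — NOT a fact, nothing of (1.22) asserted. [folklore] -/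
def CoordDerivLipschitz (M γ : ℝ) (β : HBeta) : Prop :=
  ∀ k (p : Fin (k + 1) → ℝ), p ∈ Box γ k → ∀ i : Fin (k + 1), ∃ f' : ℝ → ℝ,
    (∀ g ∈ Icc (0 : ℝ) γ, HasDerivWithinAt (fun g : ℝ => β k (Function.update p i g)) (f' g) (Icc (0 : ℝ) γ) g) ∧
    ∀ s ∈ Icc (0 : ℝ) γ, ∀ t ∈ Icc (0 : ℝ) γ, |f' s - f' t| ≤ M * |s - t|

/-- NON-VACUITY of the shape: a history-free, coupling-free family `β k v = b k` has `CoordDerivLipschitz 0 γ` (derivative `0`). [folklore] -/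
theorem coordDerivLipschitz_const (b : ℕ → ℝ) (γ : ℝ) : CoordDerivLipschitz 0 γ (fun k _ => b k) :=
  fun k _ _ _ => ⟨fun _ => 0, fun g _ => hasDerivWithinAt_const g (Icc (0 : ℝ) γ) (b k), fun s _ t _ => by simp⟩

/-- **NE4 CAPS THE OSCILLATION IN THE OLD COUPLINGS** (E33a, re-indexed to one coordinate): under `ScaleShiftRate c θ γ β` (`c ≥ 0`,
`0 < θ < 1`), two histories `p, q ∈ ]0,γ]^{k+1}` that AGREE on every coordinate younger than `n < k` satisfy
`|β_{k+1}(p) − β_{k+1}(q)| ≤ (2c∕(θ(1−θ)))·θ^{k−n}` — delete the `n+1` oldest couplings of both (`abs_sub_shift_le_geom`, kept scales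
`l = k − n − 1`); whatever the Lipschitz modulus of `β_{k+1}` in `g_0,…,g_n`.  NE4 is NOT PRINTED (GAPS G-t4-U2-1). [folklore] -/
theorem abs_sub_le_of_agree_young {β : HBeta} {c θ γ : ℝ} (hS : ScaleShiftRate c θ γ β) (hc : 0 ≤ c) (hθ0 : 0 < θ)
    (hθ1 : θ < 1) {k n : ℕ} (hnk : n < k) {p q : Fin (k + 1) → ℝ} (hp : p ∈ Box γ k) (hq : q ∈ Box γ k)
    (hagree : ∀ j : Fin (k + 1), n < (j : ℕ) → p j = q j) :
    |β k p - β k q| ≤ 2 * c / (θ * (1 - θ)) * θ ^ (k - n) := by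
  obtain ⟨l, rfl⟩ : ∃ l, k = l + (n + 1) := ⟨k - (n + 1), by omega⟩
  -- extend the histories to sequences (`ext r m = r_m` for `m ≤ k`, junk `1` beyond)
  let ext : (Fin (l + (n + 1) + 1) → ℝ) → ℕ → ℝ := fun r m => if h : m < l + (n + 1) + 1 then r ⟨m, h⟩ else 1
  have hpfx : ∀ r : Fin (l + (n + 1) + 1) → ℝ, prefixOf (ext r) (l + (n + 1)) = r := fun r => by
    funext i; have hi := i.isLt; simp only [prefixOf, ext, hi, dif_pos]
  have hbox : ∀ r : Fin (l + (n + 1) + 1) → ℝ, r ∈ Box γ (l + (n + 1)) →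
      ∀ m, m ≤ l + (n + 1) → 0 < ext r m ∧ ext r m ≤ γ := fun r hr m hm => by
    have hm' : m < l + (n + 1) + 1 := Nat.lt_succ_of_le hm
    simp only [ext, hm', dif_pos]
    exact (mem_box.mp hr) ⟨m, hm'⟩
  have hshift : prefixOf (fun m => ext p (m + (n + 1))) l = prefixOf (fun m => ext q (m + (n + 1))) l := by
    funext i
    have hi : (i : ℕ) + (n + 1) < l + (n + 1) + 1 := by have := i.isLt; omega
    simp only [prefixOf, ext, hi, dif_pos]
    exact hagree ⟨(i : ℕ) + (n + 1), hi⟩ (by simp; omega)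
  have h1 := abs_sub_shift_le_geom hS hc hθ0.le hθ1 (n + 1) l (ext p) (hbox p hp)
  have h2 := abs_sub_shift_le_geom hS hc hθ0.le hθ1 (n + 1) l (ext q) (hbox q hq)
  rw [hpfx] at h1
  rw [hpfx, ← hshift] at h2
  have hsum : |β (l + (n + 1)) p - β (l + (n + 1)) q| ≤ c * θ ^ l / (1 - θ) + c * θ ^ l / (1 - θ) := by
    rw [abs_sub_comm] at h2
    exact (abs_sub_le _ _ _).trans (add_le_add h1 h2)
  have h1θ : 0 < 1 - θ := by linarith
  rw [show l + (n + 1) - n = l + 1 by omega, show 2 * c / (θ * (1 - θ)) * θ ^ (l + 1)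
    = c * θ ^ l / (1 - θ) + c * θ ^ l / (1 - θ) by field_simp; ring]
  exact hsum

/-- **… AND A UNIFORM BOUND CAPS IT EVERYWHERE**: with `|β_{k+1}| ≤ B` on the boxes in addition, two histories agreeing on every
coordinate younger than `n ≤ k` (now `n = k`, the LAST coupling, allowed) have `|β_{k+1}(p) − β_{k+1}(q)| ≤ E₀·θ^{k−n}`,
`E₀ = max(2B, 2c∕(θ(1−θ)))`. [folklore] -/
theorem abs_sub_le_of_agree_young' {β : HBeta} {c θ γ B : ℝ} (hS : ScaleShiftRate c θ γ β) (hc : 0 ≤ c) (hθ0 : 0 < θ)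
    (hθ1 : θ < 1) (hB : ∀ k (v : Fin (k + 1) → ℝ), v ∈ Box γ k → |β k v| ≤ B) {k n : ℕ} (hnk : n ≤ k)
    {p q : Fin (k + 1) → ℝ} (hp : p ∈ Box γ k) (hq : q ∈ Box γ k) (hagree : ∀ j : Fin (k + 1), n < (j : ℕ) → p j = q j) :
    |β k p - β k q| ≤ max (2 * B) (2 * c / (θ * (1 - θ))) * θ ^ (k - n) := by
  rcases lt_or_eq_of_le hnk with hlt | heq
  · exact (abs_sub_le_of_agree_young hS hc hθ0 hθ1 hlt hp hq hagree).trans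
      (mul_le_mul_of_nonneg_right (le_max_right _ _) (pow_nonneg hθ0.le _))
  · subst heq
    rw [Nat.sub_self, pow_zero, mul_one]
    calc |β n p - β n q| ≤ |β n p| + |β n q| := abs_sub _ _
      _ ≤ B + B := add_le_add (hB n p hp) (hB n q hq)
      _ = 2 * B := by ring
      _ ≤ max (2 * B) (2 * c / (θ * (1 - θ))) := le_max_left _ _

/-! ## §3 Fading Lipschitz moduli from NE4 + regularity -/

/-- The constant of the derived moduli: `C₁ = 2E₀∕γ + Mγ∕2`, `E₀ = max(2B, 2c∕(θ(1−θ)))` (Landau step `h = (γ∕2)·τ^{age}`). [folklore] -/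
def fadingConst (c θ γ B M : ℝ) : ℝ := 2 * max (2 * B) (2 * c / (θ * (1 - θ))) / γ + M * γ / 2

/-- `0 ≤ fadingConst c θ γ B M` for `c ≥ 0`, `0 < θ < 1`, `γ > 0`, `M ≥ 0`. [folklore] -/
theorem fadingConst_nonneg {c θ γ B M : ℝ} (hc : 0 ≤ c) (hθ0 : 0 < θ) (hθ1 : θ < 1) (hγ : 0 < γ) (hM : 0 ≤ M) :
    0 ≤ fadingConst c θ γ B M := by
  have h1θ : 0 < 1 - θ := by linarith
  have hE : 0 ≤ max (2 * B) (2 * c / (θ * (1 - θ))) := le_max_of_le_right (by positivity)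
  unfold fadingConst
  positivity

/-- **COORDINATEWISE LIPSCHITZ WITH FADING CONSTANTS.**  Under `ScaleShiftRate c θ γ β` (`c ≥ 0`, `0 < θ < 1`), a uniform bound
`|β| ≤ B` on the boxes, `CoordDerivLipschitz M γ β` (`M ≥ 0`, `γ > 0`) and a rate `τ` with `θ ≤ τ²`, `0 < τ ≤ 1`: changing the ONE
coupling `g_i` of a history in `]0,γ]^{k+1}` within `]0,γ]` moves `β_{k+1}` by at most `C₁·τ^{k−i}·|Δg_i|`, `C₁ = fadingConst c θ γ B M`
— oscillation `≤ E₀θ^{k−i}` (§2) and Landau's interpolation (§1) with the step `h = (γ∕2)·τ^{k−i}`, using `θ^{a}∕τ^{a} ≤ τ^{a}`. [folklore] -/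
theorem abs_sub_update_le_of_smooth {β : HBeta} {c θ γ B M τ : ℝ} (hS : ScaleShiftRate c θ γ β) (hc : 0 ≤ c) (hθ0 : 0 < θ)
    (hθ1 : θ < 1) (hB : ∀ k (v : Fin (k + 1) → ℝ), v ∈ Box γ k → |β k v| ≤ B) (hD : CoordDerivLipschitz M γ β) (hM : 0 ≤ M)
    (hγ : 0 < γ) (hτ0 : 0 < τ) (hτ1 : τ ≤ 1) (hθτ : θ ≤ τ ^ 2) {k : ℕ} {p : Fin (k + 1) → ℝ} (hp : p ∈ Box γ k)
    (i : Fin (k + 1)) {t : ℝ} (ht : t ∈ Ioc (0 : ℝ) γ) :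
    |β k (Function.update p i t) - β k p| ≤ fadingConst c θ γ B M * τ ^ (k - i) * |t - p i| := by
  obtain ⟨f', hf', hLip⟩ := hD k p hp i
  set a : ℕ := k - i with ha
  set E₀ : ℝ := max (2 * B) (2 * c / (θ * (1 - θ))) with hE₀
  -- oscillation of the one-variable section on `]0,γ]`
  have hosc : ∀ x ∈ Ioc (0 : ℝ) γ, ∀ y ∈ Ioc (0 : ℝ) γ,
      |β k (Function.update p i x) - β k (Function.update p i y)| ≤ E₀ * θ ^ a := by
    have hbox : ∀ z ∈ Ioc (0 : ℝ) γ, Function.update p i z ∈ Box γ k := fun z hz => by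
      rw [mem_box] at hp ⊢
      intro j; by_cases hj : j = i
      · subst hj; simpa using hz
      · rw [Function.update_of_ne hj]; exact hp j
    intro x hx y hy
    refine abs_sub_le_of_agree_young' hS hc hθ0 hθ1 hB (Nat.lt_succ_iff.mp i.isLt) (hbox x hx) (hbox y hy) fun j hj => ?_
    have hji : j ≠ i := fun h => by subst h; exact lt_irrefl _ hj
    rw [Function.update_of_ne hji, Function.update_of_ne hji]
  -- Landau with the step `h = (γ/2)·τ^a`
  have hτa : 0 < τ ^ a := pow_pos hτ0 a
  have hτa1 : τ ^ a ≤ 1 := pow_le_one₀ hτ0.le hτ1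
  have hh0 : 0 < γ / 2 * τ ^ a := by positivity
  have hhγ : γ / 2 * τ ^ a ≤ γ / 2 := by nlinarith
  have hderiv : ∀ x ∈ Ioc (0 : ℝ) γ, |f' x| ≤ fadingConst c θ γ B M * τ ^ a := by
    intro x hx
    have hL := abs_deriv_le_of_osc hf' hLip hM hosc hh0 hhγ hx
    -- `E₀θ^a / ((γ/2)τ^a) + M(γ/2)τ^a ≤ (2E₀/γ + Mγ/2)·τ^a`, using `θ^a ≤ τ^a·τ^a`
    have h1θ : 0 < 1 - θ := by linarith
    have hE : 0 ≤ E₀ := le_max_of_le_right (by positivity)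
    have hθa : θ ^ a ≤ τ ^ a * τ ^ a := by
      rw [← mul_pow]; exact pow_le_pow_left₀ hθ0.le (by nlinarith) a
    have hq : E₀ * θ ^ a / (γ / 2 * τ ^ a) ≤ 2 * E₀ / γ * τ ^ a := by
      rw [div_le_iff₀ hh0]
      calc E₀ * θ ^ a ≤ E₀ * (τ ^ a * τ ^ a) := mul_le_mul_of_nonneg_left hθa hE
        _ = 2 * E₀ / γ * τ ^ a * (γ / 2 * τ ^ a) := by field_simp
    calc |f' x| ≤ E₀ * θ ^ a / (γ / 2 * τ ^ a) + M * (γ / 2 * τ ^ a) := hL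
      _ ≤ 2 * E₀ / γ * τ ^ a + M * (γ / 2 * τ ^ a) := add_le_add hq le_rfl
      _ = fadingConst c θ γ B M * τ ^ a := by simp only [fadingConst, hE₀]; ring
  have hpi : p i ∈ Ioc (0 : ℝ) γ := (mem_box.mp hp) i
  have key := abs_sub_le_of_deriv_bound hf' hderiv hpi ht
  rwa [Function.update_eq_self] at key

section Telescope

variable {β : HBeta} {k : ℕ} {γ : ℝ} {Λ : ℕ → ℕ → ℝ}

/-- The interpolating histories: `q` on the coordinates `< m`, `p` on the others. [folklore] -/
private def hybrid (p q : Fin (k + 1) → ℝ) (m : ℕ) : Fin (k + 1) → ℝ :=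
  fun i => if (i : ℕ) < m then q i else p i

/-- The hybrids stay in the box. [folklore] -/
private theorem hybrid_mem_box {p q : Fin (k + 1) → ℝ} (hp : p ∈ Box γ k) (hq : q ∈ Box γ k) (m : ℕ) :
    hybrid p q m ∈ Box γ k := by
  rw [mem_box] at hp hq ⊢
  intro i
  by_cases h : (i : ℕ) < m
  · simpa [hybrid, h] using hq i
  · simpa [hybrid, h] using hp i

/-- One more coordinate switched = one `Function.update`. [folklore] -/
private theorem hybrid_succ (p q : Fin (k + 1) → ℝ) {m : ℕ} (hm : m < k + 1) :
    hybrid p q (m + 1) = Function.update (hybrid p q m) ⟨m, hm⟩ (q ⟨m, hm⟩) := by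
  funext i
  by_cases hi : i = ⟨m, hm⟩
  · subst hi
    simp [hybrid]
  · have hne : (i : ℕ) ≠ m := fun h => hi (Fin.ext h)
    rw [Function.update_of_ne hi]
    simp only [hybrid]
    by_cases hlt : (i : ℕ) < m
    · simp [hlt, Nat.lt_succ_of_lt hlt]
    · have : ¬ (i : ℕ) < m + 1 := by omega
      simp [hlt, this]

/-- **TELESCOPING WITH COORDINATE-DEPENDENT CONSTANTS**: if changing coordinate `i` alone costs `Λ k i·|Δg_i|` on the box (all `k`, `i`),
then `HistLipschitz Λ γ β` — `|β_{k+1}(p) − β_{k+1}(q)| ≤ Σ_i Λ k i·|p_i − q_i|` (switch the coordinates one at a time inside the box;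
`BetaDerivClause.abs_sub_le_sum_of_coordLipschitz` is the constant-`Λ` case). [folklore] -/
theorem histLipschitz_of_coordModuli
    (h : ∀ k (p : Fin (k + 1) → ℝ), p ∈ Box γ k → ∀ (i : Fin (k + 1)) (t : ℝ), t ∈ Ioc (0 : ℝ) γ →
      |β k (Function.update p i t) - β k p| ≤ Λ k i * |t - p i|) :
    HistLipschitz Λ γ β := by
  intro k p q hp hq
  have main : ∀ m : ℕ, m ≤ k + 1 →
      |β k (hybrid p q m) - β k p| ≤ ∑ i ∈ (Finset.univ.filter fun i : Fin (k + 1) => (i : ℕ) < m), Λ k i * |p i - q i| := by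
    intro m
    induction m with
    | zero => intro _; simp [show hybrid p q 0 = p from funext fun i => by simp [hybrid]]
    | succ m ih =>
      intro hm
      have hm' : m < k + 1 := Nat.lt_of_succ_le hm
      have ihm := ih hm'.le
      have hz : hybrid p q m ∈ Box γ k := hybrid_mem_box hp hq m
      have hqm : q ⟨m, hm'⟩ ∈ Ioc (0 : ℝ) γ := (mem_box.mp hq) ⟨m, hm'⟩
      have step := h k (hybrid p q m) hz ⟨m, hm'⟩ (q ⟨m, hm'⟩) hqm
      rw [← hybrid_succ p q hm', show hybrid p q m ⟨m, hm'⟩ = p ⟨m, hm'⟩ by simp [hybrid]] at step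
      have hfilter : (Finset.univ.filter fun i : Fin (k + 1) => (i : ℕ) < m + 1)
          = insert ⟨m, hm'⟩ (Finset.univ.filter fun i : Fin (k + 1) => (i : ℕ) < m) := by
        ext i
        simp only [Finset.mem_filter, Finset.mem_univ, true_and, Finset.mem_insert]
        constructor
        · intro hi
          by_cases he : (i : ℕ) = m
          · left; exact Fin.ext he
          · right; omega
        · rintro (hi | hi)
          · rw [hi]; exact Nat.lt_succ_self m
          · omega
      have hnot : (⟨m, hm'⟩ : Fin (k + 1)) ∉ (Finset.univ.filter fun i : Fin (k + 1) => (i : ℕ) < m) := by simp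
      rw [hfilter, Finset.sum_insert hnot]
      calc |β k (hybrid p q (m + 1)) - β k p|
          ≤ |β k (hybrid p q (m + 1)) - β k (hybrid p q m)| + |β k (hybrid p q m) - β k p| := abs_sub_le _ _ _
        _ ≤ Λ k (⟨m, hm'⟩ : Fin (k + 1)) * |q ⟨m, hm'⟩ - p ⟨m, hm'⟩|
            + ∑ i ∈ (Finset.univ.filter fun i : Fin (k + 1) => (i : ℕ) < m), Λ k i * |p i - q i| := add_le_add step ihm
        _ = _ := by rw [abs_sub_comm (q _) (p _)]
  have hall : (Finset.univ.filter fun i : Fin (k + 1) => (i : ℕ) < k + 1) = Finset.univ := by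
    ext i; simpa using i.is_lt
  have := main (k + 1) le_rfl
  rwa [show hybrid p q (k + 1) = q from funext fun i => by simp [hybrid, i.is_lt], hall, abs_sub_comm] at this

end Telescope

/-- **HEADLINE — FADING MEMORY FROM NE4 + REGULARITY.**  Under `ScaleShiftRate c θ γ β` (`c ≥ 0`, `0 < θ < 1`), `|β| ≤ B` on the boxes,
`CoordDerivLipschitz M γ β` (`M ≥ 0`, `γ > 0`) and any rate `τ ∈ ]0,1]` with `θ ≤ τ²`: the moduli `Λ₁ k i := C₁·τ^{k−i}`,
`C₁ = fadingConst c θ γ B M`, satisfy `HistLipschitz Λ₁ γ β ∧ FadingMemory C₁ τ Λ₁` — node U2's two history companions of NE4, with the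
DECAY derived, not assumed. [folklore] -/
theorem histLipschitz_fadingMemory_of_smooth {β : HBeta} {c θ γ B M τ : ℝ} (hS : ScaleShiftRate c θ γ β) (hc : 0 ≤ c)
    (hθ0 : 0 < θ) (hθ1 : θ < 1) (hB : ∀ k (v : Fin (k + 1) → ℝ), v ∈ Box γ k → |β k v| ≤ B) (hD : CoordDerivLipschitz M γ β)
    (hM : 0 ≤ M) (hγ : 0 < γ) (hτ0 : 0 < τ) (hτ1 : τ ≤ 1) (hθτ : θ ≤ τ ^ 2) :
    HistLipschitz (fun k i => fadingConst c θ γ B M * τ ^ (k - i)) γ β ∧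
      FadingMemory (fadingConst c θ γ B M) τ (fun k i => fadingConst c θ γ B M * τ ^ (k - i)) := by
  refine ⟨histLipschitz_of_coordModuli fun k p hp i t ht => ?_, fun k i _ => ⟨?_, le_rfl⟩⟩
  · exact abs_sub_update_le_of_smooth hS hc hθ0 hθ1 hB hD hM hγ hτ0 hτ1 hθτ hp i ht
  · exact mul_nonneg (fadingConst_nonneg hc hθ0 hθ1 hγ hM) (pow_nonneg hτ0.le _)

/-! ## §4 Node U2 closes WITHOUT a fading hypothesis — geometric, K-uniform; and the faces on the data

TWO RADII.  `C₁ = fadingConst c θ γᵤ B M ≥ 4B∕γᵤ` carries the inverse of the REGULARITY box (the Landau step is `≤ γᵤ∕2`), while node U2's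
AF weight sum along runs in `]0,γ]` is `U = (k₀+1)γ³ + 2γ∕b`; with ONE radius `γ = γᵤ` the window `C₁·U ≤ (1−τ)∕2` never holds (`C₁·U ≥ 8B∕b
≥ 8`, as `B ≥ b`).  So the β-side hypotheses live on a FIXED box `]0,γᵤ]` ([Balaban1987RG1] Thm 3's `γ`), the runs in `]0,γ]`, `γ ≤ γᵤ`, and the
window `C₁(γᵤ)·((k₀+1)γ³ + 2γ∕b) ≤ (1−τ)∕2` holds once `γ∕γᵤ ≲ b(1−τ)∕(16B)` — the «every `γ ≤ γᵤ` small enough» form of `Targets.u2Output_under`. -/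

/-- **NODE U2, NO FADING HYPOTHESIS (β-generic, two radii).**  NE4 as `ScaleShiftRate c θ γᵤ β`, the uniform bound `|β| ≤ B` and the
regularity `CoordDerivLipschitz M γᵤ β` on the box `]0,γᵤ]`; two IR-pinned runs of (0.20) in `]0,γ]`, `γ ≤ γᵤ` (A: `K` steps, B: `K+1`
steps, `g^A_K = g^B_{K+1}`), the AF weight bound `Σ_{i≤K}(g^A_i)²g^B_{i+1} ≤ U` and the window `C₁·U ≤ (1−τ)∕2`, `C₁ = fadingConst c θ γᵤ B M`
(`θ ≤ τ²`, `0 < τ < 1`) give the GEOMETRIC, K-UNIFORM matching `|1∕(g^A_j)² − 1∕(g^B_{j+1})²| ≤ (2c∕(1−τ))·τ^j`, `j ≤ K` —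
`T4CouplingMatching.disc_le_of_fadingMemory` at rate `τ` with the DERIVED moduli of `histLipschitz_fadingMemory_of_smooth` (restricted to
`]0,γ]`; `ScaleShiftRate` worsened from `θ` to `τ`, `T4BetaReadOut.scaleShiftRate_mono`).  Every β-side hypothesis UNPRINTED except the
TYPE of the regularity clause. [cite: Balaban1987RG1, (0.20) p.256 and §1 p.264] -/
theorem disc_le_of_smooth {β : HBeta} {c θ γ γu B M τ U : ℝ} {K : ℕ} {gA gB : ℕ → ℝ} (hS : ScaleShiftRate c θ γu β)
    (hc : 0 ≤ c) (hθ0 : 0 < θ) (hθ1 : θ < 1) (hB : ∀ k (v : Fin (k + 1) → ℝ), v ∈ Box γu k → |β k v| ≤ B)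
    (hD : CoordDerivLipschitz M γu β) (hM : 0 ≤ M) (hγu : 0 < γu) (hγle : γ ≤ γu) (hτ0 : 0 < τ) (hτ1 : τ < 1)
    (hθτ : θ ≤ τ ^ 2) (hA : RGEqH K β gA) (hBr : RGEqH (K + 1) β gB)
    (hAbox : ∀ i, i ≤ K → 0 < gA i ∧ gA i ≤ γ) (hBbox : ∀ i, i ≤ K + 1 → 0 < gB i ∧ gB i ≤ γ) (hpin : gA K = gB (K + 1))
    (hU : ∑ i ∈ Finset.range (K + 1), (gA i) ^ 2 * gB (i + 1) ≤ U) (hsmall : fadingConst c θ γu B M * U ≤ (1 - τ) / 2) :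
    ∀ j, j ≤ K → disc gA gB j ≤ 2 * c / (1 - τ) * τ ^ j := by
  obtain ⟨hL, hF⟩ := histLipschitz_fadingMemory_of_smooth hS hc hθ0 hθ1 hB hD hM hγu hτ0 hτ1.le hθτ
  have hθτ' : θ ≤ τ := hθτ.trans (by nlinarith)
  have hS' := T4BetaReadOut.scaleShiftRate_mono hc hθ0.le hθτ' hS
  exact disc_le_of_fadingMemory hτ0 hτ1 hc (fadingConst_nonneg hc hθ0 hθ1 hγu hM) hA hBr hAbox hBbox hpin
    (fun k w hw => hS' k w (box_mono hγle (k + 1) hw)) (fun k p q hp hq => hL k p q (box_mono hγle k hp) (box_mono hγle k hq))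
    hF hU hsmall

variable {F : T4Family} {G : Type u} [GaugeGroup G] [MeasurableSpace G] [HaarData G]

/-- **ON THE DATA: NODE U2's INPUT TRIPLE FROM NE4 + REGULARITY.**  `NE4OnData D c θ γᵤ` (NE4 for Bałaban's data), `|D.βfun| ≤ B` and
`CoordDerivLipschitz M γᵤ D.βfun` on the boxes `]0,γᵤ]` give `U2Inputs D c C₁ τ γᵤ Λ₁` (`Spine/NE4/Targets`) at every rate `τ ∈ ]0,1]`
with `θ ≤ τ²`, `Λ₁ k i = C₁·τ^{k−i}`, `C₁ = fadingConst c θ γᵤ B M`: the triple's third member is no longer an input (restrict to smaller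
boxes with `U2Inputs.mono`, the constant unchanged). [folklore] -/
theorem u2Inputs_of_smooth (D : FiniteEpsData F G) {c θ γu B M τ : ℝ} (hN : NE4OnData D c θ γu) (hc : 0 ≤ c) (hθ0 : 0 < θ)
    (hθ1 : θ < 1) (hB : ∀ k (v : Fin (k + 1) → ℝ), v ∈ Box γu k → |D.βfun k v| ≤ B) (hD : CoordDerivLipschitz M γu D.βfun)
    (hM : 0 ≤ M) (hγu : 0 < γu) (hτ0 : 0 < τ) (hτ1 : τ ≤ 1) (hθτ : θ ≤ τ ^ 2) :
    U2Inputs D c (fadingConst c θ γu B M) τ γu (fun k i => fadingConst c θ γu B M * τ ^ (k - i)) := by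
  have hθτ' : θ ≤ τ := hθτ.trans (by nlinarith)
  exact ⟨T4BetaReadOut.scaleShiftRate_mono hc hθ0.le hθτ' hN,
    histLipschitz_fadingMemory_of_smooth hN hc hθ0 hθ1 hB hD hM hγu hτ0 hτ1 hθτ⟩

/-- **ON THE DATA: NODE U2's OUTPUT WITHOUT A FADING BINDER (two radii).**  NE4 for the data, `|D.βfun| ≤ B` and
`CoordDerivLipschitz M γᵤ D.βfun` on `]0,γᵤ]`; on a box `]0,γ]`, `γ ≤ γᵤ`, the AF binders `EventualLowerH b γ k₀` (`b > 0`) and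
`BetaUpperH β′ γ` (`γ²β′ < 1`), a sequence `g₀` TUNED to `g` within `]0,γ]`, a rate `τ ∈ ]0,1[` with `θ ≤ τ²`, and the window
`C₁(γᵤ)·((k₀+1)γ³ + 2γ∕b) ≤ (1−τ)∕2` give `U2Output D g₀ (2c∕(1−τ)) τ` — `u2Output_of_u2Inputs` on `(u2Inputs_of_smooth …).mono`.  Node U6's
typed source, geometric and K-uniform, from NE4 + a regularity BOUND instead of NE4 + moduli + their decay. [folklore] -/
theorem u2Output_of_smooth (D : FiniteEpsData F G) {c θ γ γu B M τ b β' g : ℝ} {k₀ : ℕ} {g₀ : ℕ → ℝ}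
    (hN : NE4OnData D c θ γu) (hc : 0 ≤ c) (hθ0 : 0 < θ) (hθ1 : θ < 1)
    (hB : ∀ k (v : Fin (k + 1) → ℝ), v ∈ Box γu k → |D.βfun k v| ≤ B) (hD : CoordDerivLipschitz M γu D.βfun) (hM : 0 ≤ M)
    (hγu : 0 < γu) (hγ : 0 < γ) (hγle : γ ≤ γu) (hτ0 : 0 < τ) (hτ1 : τ < 1) (hθτ : θ ≤ τ ^ 2) (hb : 0 < b)
    (hlo : EventualLowerH b γ k₀ D.βfun) (hhi : BetaUpperH β' γ D.βfun) (hγβ : γ ^ 2 * β' < 1) (ht : D.Tuned γ g g₀)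
    (hsmall : fadingConst c θ γu B M * (((k₀ : ℝ) + 1) * γ ^ 3 + 2 * γ / b) ≤ (1 - τ) / 2) :
    U2Output D g₀ (2 * c / (1 - τ)) τ :=
  u2Output_of_u2Inputs D ((u2Inputs_of_smooth D hN hc hθ0 hθ1 hB hD hM hγu hτ0 hτ1.le hθτ).mono hγle) hγ hb hτ0 hτ1 hc
    (fadingConst_nonneg hc hθ0 hθ1 hγu hM) hlo hhi hγβ ht hsmall

end Summit.QuantumFields.BalabanUV.T4Continuum.Spine.NE4

end
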